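import Literature.Probability.Percolation.ArmSeparationIntLand
import Literature.Probability.Percolation.ArmSeparationSepInitWide
import Literature.Probability.Percolation.ArmSeparationIntSurgery
import Literature.Probability.Percolation.ArmSeparationSchemeFin
import HarnessLib

/-!
# Separation of the internal extremities: `P(extTwoArm n N) ≤ C · P(sepTwoArm n N)`

Topic: Probability / Percolation; family `crit-perc`. A brick of the discharge of
`Literature.Probability.Percolation.Nolin2008_twoArm_separation` (Nolin 2008, Thm. 11
[arXiv 0711.4948: Thm. 10]; `ArmSeparation.lean`): the internal half of the arm separation
theorem. For the two-arm event whose *external* extremities are already landed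
(`extTwoArm n N`: both arms end on the fence of `∂Λ_N` in their landing areas) the *internal*
extremities can be landed too, at bounded cost:
`P(extTwoArm n N) ≤ C · P(sepTwoArm n N)` for `n ≥ n₀`, `N ≥ 2n`
(`exists_extTwoArm_le_mul_sepTwoArm`).

The proof is Nolin's induction scheme (§4.4) read inwards along the dyadic ladder
`r_j = 2^j (n+1) - 1` (`ladder`), assembled by `le_mul_of_separationScheme_upto` from the four
bricks: the surgery step `real_extTwoArm_le_step` with the failure estimate `real_not_inGoodF_le`
(constants `T, K, K_g` chosen so that `ε C₀² ≤ 1/2`), the landing inequality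
`exists_hland_const` (smallest scale `k₀ = m / D`, `D = 256 · 32^(K + K_g)`), the inward
extension `exists_real_sepTwoArm_le_mul_inward` (`C₀`) and the initial estimate
`exists_le_real_sepTwoArm_wide` at the top rung.

## References

* P. Nolin, *Near-critical percolation in two dimensions*, Electron. J. Probab. 13 (2008), §4.4,
  proof of Thm. 11 [arXiv 0711.4948: Thm. 10]. [Nolin2008]
* H. Kesten, *Scaling relations for 2D-percolation*, Comm. Math. Phys. 109 (1987), Lemma 4. [Kesten1987]
-/

noncomputable section

open Set MeasureTheory

namespace Literature.Probability.Percolation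

open LatticeModels

/-! ### The dyadic ladder -/

/-- **The dyadic ladder** above `n`: `r_j = 2^j (n+1) - 1`, so `r_0 = n` and `r_{j+1} = 2 r_j + 1`. [cite: Nolin2008, §4.4 (arXiv 0711.4948: proof of Thm. 10, induction on the scale)] -/
def ladder (n j : ℕ) : ℕ := 2 ^ j * (n + 1) - 1

/-- `r_0 = n`. [folklore] -/
theorem ladder_zero (n : ℕ) : ladder n 0 = n := by simp [ladder]

/-- `r_{j+1} = 2 r_j + 1`. [folklore] -/
theorem ladder_succ (n j : ℕ) : ladder n (j + 1) = 2 * ladder n j + 1 := by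
  unfold ladder
  have : 1 ≤ 2 ^ j * (n + 1) := Nat.one_le_iff_ne_zero.2 (by positivity)
  rw [pow_succ, mul_comm (2 ^ j) 2, mul_assoc]; omega

/-- `n ≤ r_j`. [folklore] -/
theorem le_ladder (n j : ℕ) : n ≤ ladder n j := by
  induction j with
  | zero => rw [ladder_zero]
  | succ j ih => rw [ladder_succ]; omega

/-- The ladder is monotone. [folklore] -/
theorem ladder_mono (n : ℕ) {i j : ℕ} (hij : i ≤ j) : ladder n i ≤ ladder n j := by
  induction hij with
  | refl => exact le_rfl
  | step _ ih => rw [ladder_succ]; omega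

/-- The rungs above the bottom are odd. [folklore] -/
theorem ladder_odd (n j : ℕ) : ladder n (j + 1) % 2 = 1 := by rw [ladder_succ]; omega

/-- The target of a rung is the rung below: `(r_{j+1} - 1) / 2 = r_j`. [folklore] -/
theorem ladder_target (n j : ℕ) : (ladder n (j + 1) - 1) / 2 = ladder n j := by rw [ladder_succ]; omega

/-- The ladder is unbounded: `2^j ≤ r_j + 1`. [folklore] -/
theorem pow_le_ladder_succ (n j : ℕ) : 2 ^ j ≤ ladder n j + 1 := by
  unfold ladder
  have : 1 ≤ 2 ^ j * (n + 1) := Nat.one_le_iff_ne_zero.2 (by positivity)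
  have : 2 ^ j ≤ 2 ^ j * (n + 1) := Nat.le_mul_of_pos_right _ (by omega)
  omega

/-! ### The guards of a rung -/

/-- **The scale guards of the surgery step on a rung** `m ≥ D` with `k₀ = m / D`,
`D = 256 · 32^(K + K_g)`, `R₀ = 8 μ`. [folklore] -/
theorem rung_guards {m D K Kg : ℕ} (hD : D = 256 * 32 ^ (K + Kg)) (hm : 64 * D ≤ m) :
    (∀ j < K, 64 * trapScale (m / D) j < m) ∧ (∀ i < Kg, 32 * trapScale (8 * trapScale (m / D) K) i ≤ m) ∧
      (∀ i < Kg, 4 * trapScale (8 * trapScale (m / D) K) i < m) ∧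
      (∀ j < K, 2 * trapScale (m / D) j + 1 ≤ 8 * trapScale (m / D) K) ∧ 1 ≤ m / D ∧ 2 ≤ 8 * trapScale (m / D) K := by
  have hD1 : 1 ≤ D := by rw [hD]; have h1 : 1 ≤ 32 ^ (K + Kg) := Nat.one_le_pow _ _ (by norm_num); omega
  have hq : 64 ≤ m / D := (Nat.le_div_iff_mul_le (by omega)).2 (by linarith)
  have hqm : m / D * D ≤ m := Nat.div_mul_le_self m D
  have hXK : 1 ≤ 32 ^ K := Nat.one_le_pow _ _ (by norm_num)
  unfold trapScale
  set q := m / D with hqdef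
  have hpow : ∀ {a b : ℕ}, a ≤ b → 32 ^ a ≤ 32 ^ b := fun h => Nat.pow_le_pow_right (by norm_num) h
  refine ⟨fun j hj => ?_, fun i hi => ?_, fun i hi => ?_, fun j hj => ?_, by omega, ?_⟩
  · -- `64 q 32^j ≤ 64 q 32^K = (256 · 32^K · q) / 4 ≤ m / 4 < m`
    have h1 : q * 32 ^ j ≤ q * 32 ^ K := Nat.mul_le_mul_left _ (hpow hj.le)
    have h2 : 256 * 32 ^ K ≤ D := by
      rw [hD, pow_add]; exact Nat.mul_le_mul_left _ (Nat.le_mul_of_pos_right _ (Nat.one_le_pow _ _ (by norm_num)))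
    have h3 : q * (256 * 32 ^ K) ≤ m := (Nat.mul_le_mul_left _ h2).trans hqm
    have h4 : 1 ≤ q * 32 ^ K := Nat.one_le_iff_ne_zero.2 (by positivity)
    have h5 : q * (256 * 32 ^ K) = 256 * (q * 32 ^ K) := by ring
    omega
  · -- `32 · (8 q 32^K) 32^i = 8 q 32^K (32 · 32^i) ≤ 8 q 32^K 32^Kg ≤ q D ≤ m`
    have h1 : 32 * 32 ^ i ≤ 32 ^ Kg := by rw [← pow_succ']; exact hpow hi
    calc 32 * (8 * (q * 32 ^ K) * 32 ^ i) = 8 * (q * 32 ^ K) * (32 * 32 ^ i) := by ring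
      _ ≤ 8 * (q * 32 ^ K) * 32 ^ Kg := Nat.mul_le_mul_left _ h1
      _ = 8 * (q * (32 ^ K * 32 ^ Kg)) := by ring
      _ ≤ 256 * (q * (32 ^ K * 32 ^ Kg)) := Nat.mul_le_mul_right _ (by norm_num)
      _ = q * D := by rw [hD, pow_add]; ring
      _ ≤ m := hqm
  · have h1 : 32 * 32 ^ i ≤ 32 ^ Kg := by rw [← pow_succ']; exact hpow hi
    have h2 : 32 * (8 * (q * 32 ^ K) * 32 ^ i) ≤ m :=
      calc 32 * (8 * (q * 32 ^ K) * 32 ^ i) = 8 * (q * 32 ^ K) * (32 * 32 ^ i) := by ring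
        _ ≤ 8 * (q * 32 ^ K) * 32 ^ Kg := Nat.mul_le_mul_left _ h1
        _ = 8 * (q * (32 ^ K * 32 ^ Kg)) := by ring
        _ ≤ 256 * (q * (32 ^ K * 32 ^ Kg)) := Nat.mul_le_mul_right _ (by norm_num)
        _ = q * D := by rw [hD, pow_add]; ring
        _ ≤ m := hqm
    have h3 : 1 ≤ 8 * (q * 32 ^ K) * 32 ^ i := Nat.one_le_iff_ne_zero.2 (by positivity)
    omega
  · have h1 : q * 32 ^ j ≤ q * 32 ^ K := Nat.mul_le_mul_left _ (hpow hj.le)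
    have h4 : 1 ≤ q * 32 ^ K := Nat.one_le_iff_ne_zero.2 (by positivity)
    omega
  · have h4 : 1 ≤ q * 32 ^ K := Nat.one_le_iff_ne_zero.2 (by positivity)
    omega

/-! ### The constants of the failure estimate -/

/-- **Choice of `T, K, K_g`**: for `0 ≤ a, b < 1` and `δ > 0` there are `T`, `K ≥ 1`, `K_g` with
`a^(T+1) + T b^K + 2 b^(K_g) < 3 δ`. [cite: Nolin2008, §4.4 (arXiv 0711.4948: proof of Thm. 10, choice of the constants)] -/
theorem exists_small_failure {a b δ : ℝ} (ha0 : 0 ≤ a) (ha1 : a < 1) (hb0 : 0 ≤ b) (hb1 : b < 1) (hδ : 0 < δ) :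
    ∃ T K Kg : ℕ, 1 ≤ K ∧ a ^ (T + 1) + T * b ^ K + 2 * b ^ Kg < 3 * δ := by
  obtain ⟨T, hT⟩ := exists_pow_lt_of_lt_one hδ ha1
  obtain ⟨K₁, hK₁⟩ := exists_pow_lt_of_lt_one (div_pos hδ (by positivity : (0 : ℝ) < T + 1)) hb1
  obtain ⟨Kg, hKg⟩ := exists_pow_lt_of_lt_one (half_pos hδ) hb1
  refine ⟨T, K₁ + 1, Kg, by omega, ?_⟩
  have h1 : a ^ (T + 1) ≤ a ^ T := pow_le_pow_of_le_one ha0 ha1.le (Nat.le_succ T)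
  have h2 : b ^ (K₁ + 1) ≤ b ^ K₁ := pow_le_pow_of_le_one hb0 hb1.le (Nat.le_succ K₁)
  have hT0 : (0 : ℝ) ≤ T := Nat.cast_nonneg T
  have h3 : (T : ℝ) * b ^ (K₁ + 1) ≤ T * (δ / (T + 1)) := by
    have := mul_le_mul_of_nonneg_left (h2.trans hK₁.le) hT0; exact this
  have h4 : (T : ℝ) * (δ / (T + 1)) ≤ δ := by
    rw [mul_div_assoc']
    rw [div_le_iff₀ (by positivity)]
    nlinarith
  linarith

/-! ### The internal separation theorem -/

/-- **Landing the internal extremities costs a bounded factor**: there are `C > 0` and `n₀` with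
`P_{1/2}(extTwoArm n N) ≤ C · P_{1/2}(sepTwoArm n N)` for all `n ≥ n₀` and `N ≥ 2n` — the
internal half of Nolin's Thm. 11 (Kesten's arm separation), by the induction scheme of §4.4 read
inwards along the dyadic ladder. [cite: Nolin2008, §4.4 Thm. 11 (arXiv 0711.4948: Thm. 10), internal extremities; Kesten1987, Lemma 4] -/
theorem exists_extTwoArm_le_mul_sepTwoArm :
    ∃ C : ℝ, 0 < C ∧ ∃ n₀ : ℕ, ∀ n N : ℕ, n₀ ≤ n → 2 * n ≤ N →
      (triSitePercolation half).real (extTwoArm n N) ≤ C * (triSitePercolation half).real (sepTwoArm n N) := by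
  -- the constants
  obtain ⟨C₀, hC₀, hinw⟩ := exists_real_sepTwoArm_le_mul_inward
  obtain ⟨ci, hci, hinit⟩ := exists_le_real_sepTwoArm_wide
  obtain ⟨cF, hcF, hF⟩ := exists_pos_le_real_triFrameAt
  obtain ⟨c24, hc24, hrsw24⟩ := tri_rsw_half_holds 24 (by norm_num)
  have hc24le : c24 ≤ 1 := (hrsw24 1 (by norm_num)).1.trans measureReal_le_one
  have hcFle : cF ≤ 1 := (hF 0 1 le_rfl).trans measureReal_le_one
  set a : ℝ := 1 - c24 ^ 5 with ha
  set b : ℝ := 1 - cF ^ 2 with hb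
  have ha0 : 0 ≤ a := by rw [ha]; linarith [pow_le_one₀ hc24.le hc24le (n := 5)]
  have ha1 : a < 1 := by rw [ha]; linarith [pow_pos hc24 5]
  have hb0 : 0 ≤ b := by rw [hb]; linarith [pow_le_one₀ hcF.le hcFle (n := 2)]
  have hb1 : b < 1 := by rw [hb]; linarith [pow_pos hcF 2]
  have hC₀0 : 0 < C₀ := lt_of_lt_of_le one_pos hC₀
  set δ : ℝ := 1 / (72 * C₀ ^ 2) with hδ
  have hδ0 : 0 < δ := by positivity
  obtain ⟨T, K, Kg, hK1, hsmall⟩ := exists_small_failure ha0 ha1 hb0 hb1 hδ0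
  set ε : ℝ := 12 * (a ^ (T + 1) + T * b ^ K + 2 * b ^ Kg) with hε
  have hε0 : 0 ≤ ε := by positivity
  have hεC : ε * C₀ ^ 2 ≤ 1 / 2 := by
    have h1 : ε ≤ 36 * δ := by rw [hε]; linarith
    have hC₀ne : C₀ ^ 2 ≠ 0 := by positivity
    have h2 : 36 * δ * C₀ ^ 2 = 1 / 2 := by rw [hδ]; field_simp; ring
    have h3 := mul_le_mul_of_nonneg_right h1 (sq_nonneg C₀)
    linarith
  set D : ℕ := 256 * 32 ^ (K + Kg) with hD
  have hDK : 256 * 32 ^ K ≤ D := by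
    rw [hD, pow_add]; exact Nat.mul_le_mul_left _ (Nat.le_mul_of_pos_right _ (Nat.one_le_pow _ _ (by norm_num)))
  obtain ⟨C₁, hC₁, hland⟩ := exists_hland_const D K hK1 hDK
  -- the statement
  refine ⟨2 * C₁ + 1 / ci, by positivity, 64 * D + 1100, fun n N hn hN => ?_⟩
  have hn1100 : 1100 ≤ n := le_trans (Nat.le_add_left _ _) hn
  have hnD : 64 * D ≤ n := le_trans (Nat.le_add_right _ _) hn
  set μ := triSitePercolation half with hμ
  have hP1 : ∀ s : Set (SiteConfig (Site 2)), μ.real s ≤ 1 := fun s => measureReal_le_one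
  have hP0 : ∀ s : Set (SiteConfig (Site 2)), 0 ≤ μ.real s := fun s => measureReal_nonneg
  -- small `N`: the initial estimate alone
  by_cases hsmallN : N < 2 * ladder n 1
  · have h1 : ci ≤ μ.real (sepTwoArm n N) := hinit n N hn1100 hN (by rw [ladder_succ, ladder_zero] at hsmallN; omega)
    have h2 : 1 ≤ 1 / ci * μ.real (sepTwoArm n N) := by
      rw [one_div, inv_mul_eq_div, le_div_iff₀ hci]; linarith
    calc μ.real (extTwoArm n N) ≤ 1 := hP1 _
      _ ≤ 1 / ci * μ.real (sepTwoArm n N) := h2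
      _ ≤ (2 * C₁ + 1 / ci) * μ.real (sepTwoArm n N) := by
          have := hP0 (sepTwoArm n N); nlinarith
  push Not at hsmallN
  -- the top of the ladder: the largest `J ≥ 1` with `2 r_J ≤ N`
  have hex : ∃ j, N < 2 * ladder n (j + 1) := by
    refine ⟨N, ?_⟩
    have h1 := pow_le_ladder_succ n (N + 1)
    have h2 : N + 1 < 2 ^ (N + 1) := Nat.lt_two_pow_self
    omega
  classical
  set J := Nat.find hex with hJ
  have hJspec : N < 2 * ladder n (J + 1) := Nat.find_spec hex
  have hJ1 : 1 ≤ J := by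
    by_contra h
    have hJ0 : J = 0 := by omega
    rw [hJ0, zero_add] at hJspec
    omega
  have hJle : 2 * ladder n J ≤ N := by
    have := Nat.find_min hex (show J - 1 < J by omega)
    rw [show J - 1 + 1 = J by omega] at this
    omega
  -- the rungs `ρ K' = r_{J - K'}`
  set ρ : ℕ → ℕ := fun K' => ladder n (J - K') with hρ
  have hρJ : ρ J = n := by simp only [hρ, Nat.sub_self, ladder_zero]
  have hρsucc : ∀ K', K' + 1 ≤ J → ρ K' = 2 * ρ (K' + 1) + 1 := fun K' hK' => by
    simp only [hρ]; rw [show J - K' = (J - (K' + 1)) + 1 by omega, ladder_succ]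
  have hρtgt : ∀ K', K' + 1 ≤ J → (ρ K' - 1) / 2 = ρ (K' + 1) := fun K' hK' => by rw [hρsucc K' hK']; omega
  have hρodd : ∀ K', K' + 1 ≤ J → ρ K' % 2 = 1 := fun K' hK' => by rw [hρsucc K' hK']; omega
  have hρn : ∀ K', n ≤ ρ K' := fun K' => le_ladder _ _
  have hρle : ∀ K', 1 ≤ K' → ρ K' ≤ ladder n (J - 1) := fun K' hK' => ladder_mono n (by omega)
  have hJ' : ladder n J = 2 * ladder n (J - 1) + 1 := by
    conv_lhs => rw [show J = J - 1 + 1 by omega]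
    exact ladder_succ n (J - 1)
  have hρN : ∀ K', 1 ≤ K' → 2 * ρ K' ≤ N := fun K' hK' => by
    have h1 := hρle K' hK'
    omega
  have hρ0N : 2 * ρ 0 ≤ N := by simp only [hρ, Nat.sub_zero]; exact hJle
  have hρmono : ∀ K', ρ (K' + 1) ≤ ρ K' := fun K' => ladder_mono n (by omega)
  -- the three sequences
  set f : ℕ → ℝ := fun K' => μ.real (extTwoArm (ρ K') N) with hf
  set g : ℕ → ℝ := fun K' => μ.real (IntTinyExt (ρ K') N (ρ K' / D) K (8 * trapScale (ρ K' / D) K)) with hg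
  set h : ℕ → ℝ := fun K' => μ.real (sepTwoArm (ρ K') N) with hh
  have hrsw24' : ∀ q : ℕ, 1 ≤ ⌊(24 : ℝ) * q⌋₊ → c24 ≤ triLRCrossingProb half ⌊(24 : ℝ) * q⌋₊ q := fun q hq => (hrsw24 q hq).1
  have key := le_mul_of_separationScheme_upto (f := f) (g := g) (h := h) (k := 0) (L := J) hε0 hC₀ hC₁ hci hεC
    (fun K' => hP1 _) (fun K' => hP0 _) (by omega)
    (fun K' hK' hK'J => measureReal_mono (extTwoArm_mono (hρmono K') (by have := hρN K' hK'; omega)) (measure_ne_top _ _))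
    (fun K' _ hK'J => by
      -- the surgery step on the rung `m = ρ (K'+1)`, `2m + 1 = ρ K'`
      have hm64 : 64 * D ≤ ρ (K' + 1) := hnD.trans (hρn _)
      obtain ⟨gKm, gRg, gRg', gKR, gk₀, gR₀⟩ := rung_guards (K := K) (Kg := Kg) hD hm64
      have hm5 : 5 ≤ ρ (K' + 1) := le_trans (by norm_num) ((hn1100).trans (hρn _))
      have hNN : 2 * (2 * ρ (K' + 1) + 1) ≤ N := by
        rw [← hρsucc K' hK'J]
        rcases Nat.eq_zero_or_pos K' with h0 | h0
        · rw [h0]; exact hρ0N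
        · exact hρN K' h0
      have step := real_extTwoArm_le_step (T := T) (Kg := Kg) hm5 hNN gR₀ gKm gRg gRg'
      have hm8 : 8 ≤ ρ (K' + 1) := le_trans (by norm_num) (hn1100.trans (hρn _))
      have bad := real_not_inGoodF_le (T := T) (K := K) (Kg := Kg) (m := ρ (K' + 1)) hcF hF hrsw24' hc24.le
        hm8 gk₀ (by omega) gKR
      rw [← ha, ← hb, ← hε] at bad
      rw [← hρsucc K' hK'J] at step
      have hfK : 0 ≤ f K' := hP0 _
      have hbf := mul_le_mul_of_nonneg_right bad hfK
      calc f (K' + 1) ≤ g (K' + 1) + μ.real {ω | ¬ InGoodF (ρ (K' + 1)) T (ρ (K' + 1) / D) K (8 * trapScale (ρ (K' + 1) / D) K) Kg ω} *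
            f K' := step
        _ ≤ g (K' + 1) + ε * f K' := by linarith)
    (fun K' hK' hK'J => by
      -- the landing inequality on the rung `m = ρ K'`
      have h1 := hland (ρ K') N (hnD.trans (hρn _)) (hρodd K' hK'J) (le_trans (by norm_num) (hn1100.trans (hρn _)))
        (hρN K' hK')
      rw [hρtgt K' hK'J] at h1
      exact h1)
    (fun K' hK' hK'J => by
      -- the inward extension from `ρ K'` to `ρ (K'+1)`
      have h1 := hinw (ρ K') (ρ (K' + 1)) N (hn1100.trans (hρn _)) (hρsucc K' hK'J).ge
        (by rw [hρsucc K' hK'J]; have := hn1100.trans (hρn (K' + 1)); omega) (hρN K' hK')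
      exact h1)
    (by
      -- the initial estimate at the top rung `ρ 1 = r_{J-1}`
      show ci ≤ μ.real (sepTwoArm (ρ (0 + 1)) N)
      have hρ1 : ρ (0 + 1) = ladder n (J - 1) := by simp only [hρ, zero_add]
      rw [hρ1]
      refine hinit _ N (hn1100.trans (le_ladder _ _)) ?_ ?_
      · have := hρN 1 le_rfl; simp only [hρ] at this; exact this
      · have h2 : ladder n (J + 1) = 2 * (2 * ladder n (J - 1) + 1) + 1 := by rw [ladder_succ, hJ']
        rw [h2] at hJspec
        have h3 : 3 ≤ ladder n (J - 1) := le_trans (by norm_num) (hn1100.trans (le_ladder _ _))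
        omega)
    J (by omega) le_rfl
  simp only [hf, hh] at key
  rw [hρJ] at key
  exact key

end Literature.Probability.Percolation
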